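import Summits.Ventures.PercRepro.GenQFlatFacts

/-!
# PercRepro — the stays of the sets of cyclic rank `r` are the points of their flat: the rows (S2r≤) (night-4, gen 24)

Night-2's (L2) counts the STAYS of the line-type sets exactly (`mv_stay_sub_two_eq`: a move `S ↦ S ∪ x` that keeps the
coloop count puts `x` on the line of `S`).  The same characterisation holds at every cyclic rank `r`
(`card_stay_filter_eq_gen`: the stays of `S` are the points of `lineOf S ∩ G` outside `S`, `lineOf S = cl(S ∖ coloops S)`),
and the sets of cyclic rank `r` with flat `F` inject into the pairs (cyclic part, coloops) (`card_filter_lineOf_le_of_rank`),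
so the stays into the class `q − r` are bounded by the rank-`r` flats:

`mv k (q−r) (q−r) ≤ Σ_s (s − (d − k − 1 + r))·C(s, d − k − 1 + r)·BR r s`   (`mv_stay_sub_le`, `k + 1 < d`, `r ≤ q`).

At `r = 3` / `r = 4` these are the plane / solid stays rows (S2p≤) / (S2s≤) of the profile LP (the rows night-4 g23's
census needed at `(6, 17)`, `(6, 21)` — untyped until now, in their `≤` form).  Imports `GenQFlatFacts`.
-/
namespace PercRepro.Night4

open Finset ThmH SixFour GenQ PerFlat Star

variable {α : Type*} [DecidableEq α] {M : Matroid α} [M.Finite]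

/-- The stays of `S ∈ Pc (k+1) m` are exactly the points of `lineOf S ∩ G` outside `S` (every coloop class `m`). -/
theorem card_stay_filter_eq_gen {G S : Finset α} {q k m : ℕ} (hG : G ⊆ gr M)
    (hrG : M.eRk (G : Set α) = (q : ℕ∞)) (hS : S ∈ Pc M G q (k + 1) m) :
    ((G \ S).filter (fun x => mTr M (insert x S) = m)).card = ((lineOf M S ∩ G) \ S).card := by
  congr 1
  ext x
  have hS' := mem_Pc.1 hS
  have hSG := (mem_Rq.1 hS'.1).1
  simp only [Finset.mem_filter, Finset.mem_sdiff, Finset.mem_inter]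
  constructor
  · rintro ⟨⟨hxG, hxS⟩, hm⟩
    refine ⟨⟨?_, hxG⟩, hxS⟩
    unfold lineOf
    rw [mem_clF]
    by_contra hx
    have hr := (mem_Rq.1 (insert_mem_Rq hrG hS'.1 hxG)).2
    have hxcl : x ∈ M.closure (S : Set α) := by
      apply mem_closure_of_eRk_insert_le' (hG hxG)
      rw [hr, (mem_Rq.1 hS'.1).2]
    have := mTr_insert_add_one_le_of_notMem_closure (hSG.trans hG) (hG hxG) hxS hxcl hx
    rw [hm, hS'.2.2] at this
    omega
  · rintro ⟨⟨hxL, hxG⟩, hxS⟩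
    refine ⟨⟨hxG, hxS⟩, ?_⟩
    unfold lineOf at hxL
    rw [mem_clF] at hxL
    have := coloopsOf_insert_eq_of_mem_closure (hSG.trans hG) hxS hxL
    unfold mTr
    rw [this]
    exact hS'.2.2

/-- On the fiber of the flat `F`: `|(F ∩ G) ∖ S| = |F ∩ G| − (d − k − 1 + r)` for `S ∈ Pc (k+1) (q−r)` with
`lineOf S = F` (the cyclic part `S ∖ coloops S = (F ∩ G) ∩ S` has `|S| − (q − r)` points). -/
theorem card_inter_sdiff_eq_gen {G S : Finset α} {q d k r : ℕ} (hG : G ⊆ gr M)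
    (hcard : G.card = q + d) (hr : r ≤ q) (hS : S ∈ Pc M G q (k + 1) (q - r)) :
    ((lineOf M S ∩ G) \ S).card = (lineOf M S ∩ G).card - (d - k - 1 + r) := by
  have hS' := mem_Pc.1 hS
  have hSG := (mem_Rq.1 hS'.1).1
  have hsd := Finset.card_sdiff_of_subset hSG
  have hle := Finset.card_le_card hSG
  rw [hS'.2.1] at hsd
  have hinter : (lineOf M S ∩ G) ∩ S = S \ coloopsOf M S := by
    ext y
    simp only [Finset.mem_inter, Finset.mem_sdiff]
    constructor
    · rintro ⟨⟨hyL, -⟩, hyS⟩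
      refine ⟨hyS, fun hyK => ?_⟩
      exact (Finset.mem_sdiff.1 (coloopsOf_subset_sdiff_lineOf hS hyK)).2 hyL
    · intro hy
      exact ⟨Finset.mem_inter.1 (sdiff_coloopsOf_subset_lineOf_inter hG hS (Finset.mem_sdiff.2 hy)), hy.1⟩
  have h1 := Finset.card_sdiff_add_card_inter (lineOf M S ∩ G) S
  rw [hinter, card_sdiff_coloopsOf, hS'.2.2] at h1
  have hSq : q ≤ S.card := le_card_of_eRk_eq (mem_Rq.1 hS'.1).2
  omega

/-- **(S2r≤)**: the stays into the class of cyclic rank `r` are bounded by the rank-`r` flats —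
`mv k (q−r) (q−r) ≤ Σ_s (s − (d − k − 1 + r))·C(s, d − k − 1 + r)·BR r s` (`k + 1 < d`, `r ≤ q`).
`r = 2`: the line stays (night-2's (L2), there an equality); `r = 3` / `r = 4`: the plane / solid stays (S2p≤) / (S2s≤). -/
theorem mv_stay_sub_le {G : Finset α} {q d k r : ℕ} (hG : G ⊆ gr M)
    (hrG : M.eRk (G : Set α) = (q : ℕ∞)) (hr : r ≤ q) (hcard : G.card = q + d) (hk : k + 1 < d) :
    mv M G q k (q - r) (q - r) ≤
      ∑ s ∈ Finset.range (G.card + 1), (s - (d - k - 1 + r)) * s.choose (d - k - 1 + r) * BR M G q r s := by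
  classical
  unfold mv
  have hf : ∀ s, (s - (d - k - 1 + r)) * s.choose (d - k - 1 + r) * BR M G q r s
      = (fun s => (s - (d - k - 1 + r)) * s.choose (d - k - 1 + r)) s * BR M G q r s := fun s => rfl
  simp only [hf]
  rw [← sum_flats_mul_betaR_eq G q r (fun s => (s - (d - k - 1 + r)) * s.choose (d - k - 1 + r))]
  rw [← Finset.sum_fiberwise_of_maps_to (s := Pc M G q (k + 1) (q - r)) (t := flatsQ M r)
    (g := fun S => lineOf M S) (fun S hS => Finset.mem_coe.2 (lineOf_mem_flatsQ_of_Pc hG hr hS))]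
  refine Finset.sum_le_sum (fun F _ => ?_)
  have hfib := card_filter_lineOf_le_of_rank hG hrG hr hcard (by omega : k + 1 < d) (F := F)
  have hdk : d - (k + 1) + r = d - k - 1 + r := by omega
  rw [hdk] at hfib
  calc ∑ S ∈ (Pc M G q (k + 1) (q - r)).filter (fun S : Finset α => lineOf M S = F),
          ((G \ S).filter (fun x => mTr M (insert x S) = q - r)).card
      = ∑ S ∈ (Pc M G q (k + 1) (q - r)).filter (fun S : Finset α => lineOf M S = F),
          ((F ∩ G).card - (d - k - 1 + r)) := by
        refine Finset.sum_congr rfl (fun S hS => ?_)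
        have hS' := Finset.mem_filter.1 hS
        rw [card_stay_filter_eq_gen hG hrG hS'.1, card_inter_sdiff_eq_gen hG hcard hr hS'.1, hS'.2]
    _ = ((Pc M G q (k + 1) (q - r)).filter (fun S : Finset α => lineOf M S = F)).card
          * ((F ∩ G).card - (d - k - 1 + r)) := by
        rw [Finset.sum_const, smul_eq_mul]
    _ ≤ (F ∩ G).card.choose (d - k - 1 + r) * betaR M G F q r * ((F ∩ G).card - (d - k - 1 + r)) :=
        Nat.mul_le_mul_right _ hfib
    _ = ((F ∩ G).card - (d - k - 1 + r)) * (F ∩ G).card.choose (d - k - 1 + r) * betaR M G F q r := by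
        ring

end PercRepro.Night4
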